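import Literature.NumberTheory.Rogawski1990.FinExplicitTransferFactorInertPlace                      -- ★ B6-inert p839109 (B-p10 (g23))
import Literature.NumberTheory.Automorphic.Liu2021.LemD1AsPrintedIndexedNonVacuityNonsplitPlace     -- ★ `not_isSquare_delta_sq_of_nonsplit`
import Literature.NumberTheory.Automorphic.QuadraticHeckeCharacterCM                                -- ★ `cmQuadraticGenerator`, `cmQuadraticGenerator_spec` (+ ★ `algebraMap_ne_of_complexConj_eq_neg`)
import HarnessLib

/-!
# Rogawski's explicit finite transfer factor at an UNRAMIFIED NON-SPLIT place, side conditions discharged: `κ_v = (−1)^{ord_v x_v}` and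
# `Δ‴_v = ± τ_v · D_{G∕H,v}` with no square ∕ membership hypotheses (Rogawski (1990) §4.9 p. 55; O'Meara 63:16)

Topic `NumberTheory/Rogawski1990`; namespace `Literature.NumberTheory.Rogawski1990`.  THEOREMS ONLY (no definition, no named fact, no instance, no notation,
no `sorry`; net debt 0).  Cell `pub/hodgecm-mathlib`, F0∕P3a, topic T6 (#88 side; LEAD F0P3a-plan (g9) T8-2 (6): «B6-inert with `hnsq` DISCHARGED»).  The sibling of
★ `FinExplicitTransferFactorInertPlace` (B6-inert) that keeps its closure light: the two side conditions of its unramified heads are THEOREMS of the tree —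
`hnsq : θ ∉ L⁺_v²` at a non-split `v` is ★ `Liu2021.LemD1IndexedNonVacuityNonsplitPlace.not_isSquare_delta_sq_of_nonsplit` (a square root of `δ² = θ` in `L⁺_v` would be
`c`-fixed in the field `E_v`), and `hδL : δ ∉ L⁺` is ★ `NumberFields.algebraMap_ne_of_complexConj_eq_neg` (`cδ = −δ ≠ 0`) — so here they are fed in by name.

* §1 **`finKappaAt_eq_one_of_nonsplit_of_isUnramifiedIn_of_even'`**, **`finKappaAt_eq_neg_one_of_nonsplit_of_isUnramifiedIn_of_odd'`**,
  `finExplicitDelta_eq_of_nonsplit_of_isUnramifiedIn_of_even'`, `finExplicitDelta_eq_of_nonsplit_of_isUnramifiedIn_of_odd'` — ★ B6-inert's heads with `hδL`, `hnsq` gone.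
* §2 **`finKappaAt_eq_ite_even_of_nonsplit_of_isUnramifiedIn`** — at the CM generator `θ = cmQuadraticGenerator L` (★ `cmQuadraticGenerator_spec` supplies `δ`):
  `κ_v = (+1 if ord_v x₀ is even, −1 if odd)` = O'Meara's `(−1)^{ord_v x₀}`, the value of the endoscopic character `κ` on the class of `γ′` at an unramified inert place
  ([Rogawski1990 §14.6 p. 242]: «`κ(γ, ψ_v(i(γ)))` is equal to `±1`»; [LanglandsShelstad1987 §2]).
HONEST LABEL: HC_CM is proved only modulo the printed citations (named inputs remaining 2) until rung 0 closes; this file proves none of them (the inert fundamental lemma and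
inert orbital integrals are elsewhere, floor 2).

## References
* [Rogawski1990] J. D. Rogawski, *Automorphic Representations of Unitary Groups in Three Variables*, Ann. of Math. Stud. 123 (1990): §4.9 p. 55, §14.6 p. 242, §3.5 Prop. 3.5.2 (c) p. 29.
* [Omeara1963] O. T. O'Meara, *Introduction to Quadratic Forms* (1963), §63C Example 63:16, §65A.
* [LanglandsShelstad1987] R. P. Langlands, D. Shelstad, *On the definition of transfer factors*, Math. Ann. 278 (1987), §2.
* [CasselsFrohlichANT1967] J. W. S. Cassels, A. Fröhlich (eds.), *Algebraic Number Theory* (1967), Ch. II §10.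
-/

set_option autoImplicit false

noncomputable section

open NumberField IsDedekindDomain Matrix Polynomial
open scoped MatrixGroups

namespace Literature.NumberTheory.Rogawski1990

open Literature.NumberTheory.Automorphic Literature.NumberTheory.GaloisRepresentations Literature.NumberTheory.QuadraticForms
open Literature.NumberTheory.NumberFields

variable (L : Type) [Field L] [NumberField L] [IsCMField L] (v : HeightOneSpectrum (𝓞 ↥(maximalRealSubfield L)))
  (H' : Matrix (Fin 3) (Fin 3) L)
  (a : (UnitaryGroup.cmDatum L 2 (Matrix.of fun i j : Fin 2 => if i.val + j.val + 1 = 2 then (1 : L) else 0)).Local v ×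
      (UnitaryGroup.cmDatum L 1 (Matrix.of fun i j : Fin 1 => if i.val + j.val + 1 = 1 then (1 : L) else 0)).Local v)
  (b : (UnitaryGroup.cmDatum L 3 H').Local v)
  (w : UnitaryGroup.PlacesOver L v) (hw : IsCMField.complexConj L • w.1 = w.1)

/-! ## §1 ★ B6-inert's unramified heads with `hδL`, `hnsq` discharged -/

section Discharged

variable {δ : L} (hcδ : IsCMField.complexConj L δ = -δ) (hδ : δ ≠ 0) {θ : ↥(maximalRealSubfield L)} (hθ : δ * δ = algebraMap ↥(maximalRealSubfield L) L θ)

include hw hcδ hδ hθ in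
open scoped Classical in
/-- **`κ_v = +1` at an unramified non-split place when `ord_v x₀` is even** — ★ `finKappaAt_eq_one_of_nonsplit_of_isUnramifiedIn_of_even` with `δ ∉ L⁺` fed by ★
`algebraMap_ne_of_complexConj_eq_neg`. [cite: Omeara1963, §63C Example 63:16] [cite: Rogawski1990, §14.6 p. 242] -/
theorem finKappaAt_eq_one_of_nonsplit_of_isUnramifiedIn_of_even' (hunr : Algebra.IsUnramifiedIn (𝓞 L) v.asIdeal) (h : IsLocalNormPair L H' v a b)
    (hu : IsUnit ((finCharpolyTwo L v a).eval (finGammaTwo L v a))) {p' : Fin 3 → UnitaryGroup.LocalRing L v}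
    (hp' : (b.val.val : Matrix (Fin 3) (Fin 3) (UnitaryGroup.LocalRing L v)) *ᵥ p' = finGammaTwo L v a • p') (hne : p' ≠ 0)
    (x₀ : v.adicCompletion ↥(maximalRealSubfield L)) (hx₀ : x₀ ≠ 0)
    (hx : UnitaryGroup.toLocalRing L v x₀ =
      ∑ i : Fin 3, ∑ k : Fin 3, UnitaryGroup.conjLocal L (IsCMField.complexConj L) v (p' i) *
        ((UnitaryGroup.adelicForm L 3 H').map (UnitaryGroup.adeleToLocal L v)) i k * p' k)
    (heven : Even (WithZero.log (Valued.v x₀))) :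
    finKappaAt L v H' a b = 1 :=
  finKappaAt_eq_one_of_nonsplit_of_isUnramifiedIn_of_even L v H' a b w hw hcδ hδ hθ (algebraMap_ne_of_complexConj_eq_neg hcδ hδ) hunr h hu hp' hne x₀ hx₀ hx heven

include hw hcδ hδ hθ in
open scoped Classical in
/-- **`κ_v = −1` at an unramified non-split place when `ord_v x₀` is odd** — ★ `finKappaAt_eq_neg_one_of_nonsplit_of_isUnramifiedIn_of_odd` with BOTH side conditions
discharged: `δ ∉ L⁺` (★ `algebraMap_ne_of_complexConj_eq_neg`) and `θ ∉ L⁺_v²` (★ `not_isSquare_delta_sq_of_nonsplit`: `v` is non-split).  This is the class on which the endoscopic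
sign is non-trivial. [cite: Omeara1963, §63C Example 63:16] [cite: Rogawski1990, §14.6 p. 242; §3.5 Prop. 3.5.2 (c) p. 29] [cite: CasselsFrohlichANT1967, Ch. II §10] -/
theorem finKappaAt_eq_neg_one_of_nonsplit_of_isUnramifiedIn_of_odd' (hunr : Algebra.IsUnramifiedIn (𝓞 L) v.asIdeal) (h : IsLocalNormPair L H' v a b)
    (hu : IsUnit ((finCharpolyTwo L v a).eval (finGammaTwo L v a))) {p' : Fin 3 → UnitaryGroup.LocalRing L v}
    (hp' : (b.val.val : Matrix (Fin 3) (Fin 3) (UnitaryGroup.LocalRing L v)) *ᵥ p' = finGammaTwo L v a • p') (hne : p' ≠ 0)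
    (x₀ : v.adicCompletion ↥(maximalRealSubfield L)) (hx₀ : x₀ ≠ 0)
    (hx : UnitaryGroup.toLocalRing L v x₀ =
      ∑ i : Fin 3, ∑ k : Fin 3, UnitaryGroup.conjLocal L (IsCMField.complexConj L) v (p' i) *
        ((UnitaryGroup.adelicForm L 3 H').map (UnitaryGroup.adeleToLocal L v)) i k * p' k)
    (hodd : Odd (WithZero.log (Valued.v x₀))) :
    finKappaAt L v H' a b = -1 :=
  haveI : Algebra.IsQuadraticExtension ↥(maximalRealSubfield L) L := IsCMField.isQuadraticExtension L
  finKappaAt_eq_neg_one_of_nonsplit_of_isUnramifiedIn_of_odd L v H' a b w hw hcδ hδ hθ (algebraMap_ne_of_complexConj_eq_neg hcδ hδ) hunr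
    (Liu2021.LemD1IndexedNonVacuityNonsplitPlace.not_isSquare_delta_sq_of_nonsplit L v (IsCMField.complexConj L) hcδ hδ w hw hθ) h hu hp' hne x₀ hx₀ hx hodd

include hw hcδ hδ hθ in
open scoped Classical in
/-- **`Δ‴_v = τ_v · D_v` on the even class at an unramified non-split place**, no side conditions. [cite: Rogawski1990, §4.9 p. 55] [cite: Omeara1963, §63C Example 63:16] -/
theorem finExplicitDelta_eq_of_nonsplit_of_isUnramifiedIn_of_even' (μ : HeckeCharacter L) (hunr : Algebra.IsUnramifiedIn (𝓞 L) v.asIdeal)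
    (h : IsLocalNormPair L H' v a b) (hu : IsUnit ((finCharpolyTwo L v a).eval (finGammaTwo L v a))) {p' : Fin 3 → UnitaryGroup.LocalRing L v}
    (hp' : (b.val.val : Matrix (Fin 3) (Fin 3) (UnitaryGroup.LocalRing L v)) *ᵥ p' = finGammaTwo L v a • p') (hne : p' ≠ 0)
    (x₀ : v.adicCompletion ↥(maximalRealSubfield L)) (hx₀ : x₀ ≠ 0)
    (hx : UnitaryGroup.toLocalRing L v x₀ =
      ∑ i : Fin 3, ∑ k : Fin 3, UnitaryGroup.conjLocal L (IsCMField.complexConj L) v (p' i) *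
        ((UnitaryGroup.adelicForm L 3 H').map (UnitaryGroup.adeleToLocal L v)) i k * p' k)
    (heven : Even (WithZero.log (Valued.v x₀))) :
    finExplicitDelta L v H' a μ b =
      ((μ.localComponent w.1 (MulEquiv.piUnits (isUnit_finGammaTwo L v a).unit w) : ℂˣ) : ℂ) *
        (((μ.localComponent w.1 (MulEquiv.piUnits (isUnit_finTauArg_of_isUnit L v a hu).unit w) : ℂˣ) : ℂ))⁻¹ *
        (Real.sqrt ‖((finCharpolyTwo L v a).eval (finGammaTwo L v a)) w‖ : ℂ) :=
  finExplicitDelta_eq_of_nonsplit_of_isUnramifiedIn_of_even L v H' a b w hw hcδ hδ hθ μ (algebraMap_ne_of_complexConj_eq_neg hcδ hδ) hunr h hu hp' hne x₀ hx₀ hx heven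

include hw hcδ hδ hθ in
open scoped Classical in
/-- **`Δ‴_v = −τ_v · D_v` on the odd class at an unramified non-split place**, no side conditions. [cite: Rogawski1990, §4.9 p. 55; §14.6 p. 242] [cite: Omeara1963, §63C Example 63:16] -/
theorem finExplicitDelta_eq_of_nonsplit_of_isUnramifiedIn_of_odd' (μ : HeckeCharacter L) (hunr : Algebra.IsUnramifiedIn (𝓞 L) v.asIdeal)
    (h : IsLocalNormPair L H' v a b) (hu : IsUnit ((finCharpolyTwo L v a).eval (finGammaTwo L v a))) {p' : Fin 3 → UnitaryGroup.LocalRing L v}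
    (hp' : (b.val.val : Matrix (Fin 3) (Fin 3) (UnitaryGroup.LocalRing L v)) *ᵥ p' = finGammaTwo L v a • p') (hne : p' ≠ 0)
    (x₀ : v.adicCompletion ↥(maximalRealSubfield L)) (hx₀ : x₀ ≠ 0)
    (hx : UnitaryGroup.toLocalRing L v x₀ =
      ∑ i : Fin 3, ∑ k : Fin 3, UnitaryGroup.conjLocal L (IsCMField.complexConj L) v (p' i) *
        ((UnitaryGroup.adelicForm L 3 H').map (UnitaryGroup.adeleToLocal L v)) i k * p' k)
    (hodd : Odd (WithZero.log (Valued.v x₀))) :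
    finExplicitDelta L v H' a μ b =
      -(((μ.localComponent w.1 (MulEquiv.piUnits (isUnit_finGammaTwo L v a).unit w) : ℂˣ) : ℂ) *
        (((μ.localComponent w.1 (MulEquiv.piUnits (isUnit_finTauArg_of_isUnit L v a hu).unit w) : ℂˣ) : ℂ))⁻¹ *
        (Real.sqrt ‖((finCharpolyTwo L v a).eval (finGammaTwo L v a)) w‖ : ℂ)) :=
  haveI : Algebra.IsQuadraticExtension ↥(maximalRealSubfield L) L := IsCMField.isQuadraticExtension L
  finExplicitDelta_eq_of_nonsplit_of_isUnramifiedIn_of_odd L v H' a b w hw hcδ hδ hθ μ (algebraMap_ne_of_complexConj_eq_neg hcδ hδ) hunr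
    (Liu2021.LemD1IndexedNonVacuityNonsplitPlace.not_isSquare_delta_sq_of_nonsplit L v (IsCMField.complexConj L) hcδ hδ w hw hθ) h hu hp' hne x₀ hx₀ hx hodd

end Discharged

/-! ## §2 At the CM generator: `κ_v = (−1)^{ord_v x₀}` -/

include hw in
open scoped Classical in
/-- **`κ_v(γ_H, γ′) = (−1)^{ord_v x₀}` AT AN UNRAMIFIED NON-SPLIT PLACE** (O'Meara 63:16 in the tree's two signs), for `L = L⁺(√θ)` with `θ = cmQuadraticGenerator L`
(★ `cmQuadraticGenerator_spec`): `κ_v = +1` if the order of the relative position `x₀` is even, `−1` if odd — the endoscopic character on the class of `γ′`.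
[cite: Omeara1963, §63C Example 63:16] [cite: Rogawski1990, §14.6 p. 242; §3.5 Prop. 3.5.2 (c) p. 29] [cite: LanglandsShelstad1987, §2] -/
theorem finKappaAt_eq_ite_even_of_nonsplit_of_isUnramifiedIn (hunr : Algebra.IsUnramifiedIn (𝓞 L) v.asIdeal) (h : IsLocalNormPair L H' v a b)
    (hu : IsUnit ((finCharpolyTwo L v a).eval (finGammaTwo L v a))) {p' : Fin 3 → UnitaryGroup.LocalRing L v}
    (hp' : (b.val.val : Matrix (Fin 3) (Fin 3) (UnitaryGroup.LocalRing L v)) *ᵥ p' = finGammaTwo L v a • p') (hne : p' ≠ 0)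
    (x₀ : v.adicCompletion ↥(maximalRealSubfield L)) (hx₀ : x₀ ≠ 0)
    (hx : UnitaryGroup.toLocalRing L v x₀ =
      ∑ i : Fin 3, ∑ k : Fin 3, UnitaryGroup.conjLocal L (IsCMField.complexConj L) v (p' i) *
        ((UnitaryGroup.adelicForm L 3 H').map (UnitaryGroup.adeleToLocal L v)) i k * p' k) :
    finKappaAt L v H' a b = if Even (WithZero.log (Valued.v x₀)) then 1 else -1 := by
  obtain ⟨α, hα0, hcα, hsq⟩ := cmQuadraticGenerator_spec L
  have hθ : α * α = algebraMap ↥(maximalRealSubfield L) L (cmQuadraticGenerator L : ↥(maximalRealSubfield L)) := by rw [← sq]; exact hsq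
  by_cases heven : Even (WithZero.log (Valued.v x₀))
  · rw [if_pos heven]
    exact finKappaAt_eq_one_of_nonsplit_of_isUnramifiedIn_of_even' L v H' a b w hw hcα hα0 hθ hunr h hu hp' hne x₀ hx₀ hx heven
  · rw [if_neg heven]
    exact finKappaAt_eq_neg_one_of_nonsplit_of_isUnramifiedIn_of_odd' L v H' a b w hw hcα hα0 hθ hunr h hu hp' hne x₀ hx₀ hx (Int.not_even_iff_odd.1 heven)

end Literature.NumberTheory.Rogawski1990

end
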